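/-
Copyright (c) 2026 the pub-hodgecm-mathlib formalisation cell (harness21).  Prover seat hodgecm-mathlib-R90-C131-p02 (g0) (R90-TF S4 hand lent to L1
by CHAIR VALVE WORD W4), Track B «K2-LIT», hLiu418 = `stmt-HodgeConjecture-24832`; LEAD F0P6-plan (g14) BATCH #87 (2) (K1a-3-arch) + BATCH #152 (2)
«C131-p02 = the (K1a-3-arch) VALUE producer, (3c) next»; K1-a♮ line lead K2E5-p16 (g8) WORD #4 (3) «Φ-ROAD».  THEOREMS ONLY (no `def`, no instance,
no notation, no named-fact hypothesis, no `sorry`); lane `--supports stmt-HodgeConjecture-24832 --as helper`.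
-/
import Summits.HodgeConjecture.HodgeConjecture.Theorems.K2LiuArchIntertwiningScalarSection   -- ★ (A∞-R): `integrand_eq_of_posDef`, `integral_translate`, `det_im_eq` (brings ★ `integral_hermOfReal_eq`, ★ tube cocycle)
import HarnessLib

/-!
# Crux `HLiu418`, KIND 1 a♮ (K1a-3-arch), (3c) VALUE: the TWISTED archimedean big-cell integral of the scalar `K_w`-type is Shimura's confluent `ξ₂`
# `∫ e(−τ(T·X)) f⁰_{s,k}(J n(X) h) dX = det d^{−k} |det d|^{k−2s−2} · e(τ(T·U)) · ⅛ · ξ₂(V, T; s+1+k/2, s+1−k/2)` (`h·i1 = U + iV`, `d = j(h, i1)`)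

Cell `hodgecm-mathlib`, crux item hLiu418 = `stmt-HodgeConjecture-24832` (helper lane, count-neutral).  The TWISTED twin of ★ (A∞-R)
`K2LiuArchIntertwiningScalarSection.archIntertwining_archScalarSection_eq` (which is the index `T = 0` followed by the evaluation ★ `xiTwo_zero_right`):
for every `2 × 2` index matrix `T` (rank `2`, `1` or `0` — the singular rank-one `T` is the KIND 1 a♮ case), every `h ∈ U(J)` and every `k : ℤ`, `s : ℂ`,
the Fourier-type integral of the scalar-type Siegel section ★ `archScalarSection k s` over the big cell,
`∫_{Herm₂} e(−τ(T X)) f⁰_{s,k}(J · n(X) · h) dX` (`X = hermOfReal r`, Lebesgue on `Fin 2 → Fin 2 → ℝ`), EQUALS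
`det d^{−k} · |det d|^{k−2s−2} · e(τ(T U)) · (1/8) · ξ₂(V, T; s+1+k/2, s+1−k/2)`, where `h·(i1) = U + iV` (`V > 0`, ★ `posDef_im_moeb`), `d = j(h, i1)`
(★ `denom`), and `ξ₂` is ★ `xiTwo` (the Jacobian `1/8` is ★ `integral_hermOfReal_eq`).  NO abscissa hypothesis: an identity of Bochner integrals
(both sides converge absolutely for `½ < re s`, ★ `integrable_xiTwoIntegrand`).
PROOF = ★ (A∞-R)'s skeleton: `j(J n(X) h, i1) = (X + U + iV)·d` (★ `denom_J_mul_transl`, ★ `moeb_mul_denom`), so the section value is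
`det d^{−k}|det d|^{k−2s−2} · G(X + U)` with `G(Y) = det(Y+iV)^{−k}|det(Y+iV)|^{k−2s−2}`; the character is NOT translation invariant and throws off
`e(τ(TU))`: `e(−τ(TX)) = e(τ(TU)) · e(−τ(T(X+U)))` (§1 `cexp_trace_split`); translate by `U` (★ `integral_translate`), pass to the `hermTwo` chart
(★ `integral_hermOfReal_eq`), and identify the integrand with ★ `xiTwoIntegrand V T …` (§1 `twisted_integrand_eq_of_posDef`, over ★ `integrand_eq_of_posDef`).
CONSUMERS: the (K1a-4)∕D-3 arch rows (LH4-p11, R90-C14-p02): with ★ `differentiableOn_xiTwo_diag` the right side is HOLOMORPHIC ON `{½ < re s}` for every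
hermitian `T`; below `½` the singular `T` continues by ★ `xiTwo_eq_etaTwo_of_posSemidef` ∘ ★ `etaTwo_rankOne_eq` ∘ ★ `exists_continuation_jIntegral_line`
((3c-cont), next file).
* §1 `cexp_trace_split`, `twisted_integrand_eq_of_posDef`; §2 **`twistedArchIntertwining_archScalarSection_eq`**.

HONEST LABEL: one identity; closes no socket.  HC_CM is proved only modulo the 7 printed citations (2 remaining named inputs: hLiu418 =
`stmt-HodgeConjecture-24832`, h413 = `stmt-HodgeConjecture-24833`) until rung 0 closes.  REL ≠ ★ ≠ BUILT.

## References
* [Shimura1982] G. Shimura, *Confluent hypergeometric functions on tube domains*, Math. Ann. 260 (1982), (1.25), (3.2)–(3.3).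
* [Shimura1997] G. Shimura, *Euler Products and Eisenstein Series*, CBMS 93 (1997), §16.4, §18.4.
-/

set_option autoImplicit false
set_option linter.dupNamespace false

noncomputable section

open Complex MeasureTheory Set Matrix
open scoped ComplexOrder ComplexConjugate

namespace Summit.HodgeConjecture.HodgeConjecture.Cruxes.HLiu418.K2LiuArchTwistedIntertwiningScalarSection

open Literature.NumberTheory.ModularForms.SiegelUpperHalfSpace (num denom moeb num_def denom_def moeb_def moeb_mul_denom)
open Summit.HodgeConjecture.HodgeConjecture.Cruxes.HLiu418.K2LiuHermTwoGammaDefs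
open Summit.HodgeConjecture.HodgeConjecture.Cruxes.HLiu418.K2LiuHermTwoConfluentXiDefs
open Summit.HodgeConjecture.HodgeConjecture.Cruxes.HLiu418.K2LiuHermitianTubeCocycle
open Summit.HodgeConjecture.HodgeConjecture.Cruxes.HLiu418.K2LiuArchInducedTubeDefs
open Summit.HodgeConjecture.HodgeConjecture.Cruxes.HLiu418.K2LiuArchInducedTubeSection
open Summit.HodgeConjecture.HodgeConjecture.Cruxes.HLiu418.K2LiuArchIntertwiningScalarValue
open Summit.HodgeConjecture.HodgeConjecture.Cruxes.HLiu418.K2LiuArchIntertwiningScalarSection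

/-! ## §1 The character splits off `e(τ(TU))`; the twisted integrand is `xiTwoIntegrand V T` -/

/-- `e(−τ(T X)) = e(τ(T U)) · e(−τ(T (X + U)))`. [folklore] -/
theorem cexp_trace_split (T X U : Matrix (Fin 2) (Fin 2) ℂ) :
    cexp (-(2 * Real.pi * I) * (T * X).trace) =
      cexp ((2 * Real.pi * I) * (T * U).trace) * cexp (-(2 * Real.pi * I) * (T * (X + U)).trace) := by
  rw [← Complex.exp_add, Matrix.mul_add, Matrix.trace_add]
  congr 1
  ring

/-- **The twisted integrand at a general `V > 0`**: for `X = hermTwo c` and every index `T`,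
`e(−τ(T X)) · det(X+iV)^{−k}·|det(X+iV)|^{k−2s−2} = xiTwoIntegrand V T (s+1+k/2) (s+1−k/2) c` (★ `integrand_eq_of_posDef` is the case `T = 0`,
and the character is the extra factor of ★ `xiTwoIntegrand`). [Shimura1982, (1.25)] -/
theorem twisted_integrand_eq_of_posDef {V : Matrix (Fin 2) (Fin 2) ℂ} (hV : V.PosDef) (T : Matrix (Fin 2) (Fin 2) ℂ) (k : ℤ) (s : ℂ)
    (c : ℝ × ℂ × ℝ) :
    cexp (-(2 * Real.pi * I) * (T * hermTwo c).trace) *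
        ((hermTwo c + I • V).det ^ (-k) * (((‖(hermTwo c + I • V).det‖ : ℝ) : ℂ) ^ ((k : ℂ) - 2 * s - 2))) =
      xiTwoIntegrand V T (s + 1 + k / 2) (s + 1 - k / 2) c := by
  rw [integrand_eq_of_posDef hV k s c, xiTwoIntegrand_apply, xiTwoIntegrand_apply, Matrix.zero_mul, Matrix.trace_zero, mul_zero,
    Complex.exp_zero, one_mul]

/-! ## §2 The twisted big-cell integral of the scalar type is `ξ₂(V, T)` -/

/-- **(3c) VALUE — THE TWISTED ARCHIMEDEAN BIG-CELL INTEGRAL OF THE SCALAR `K_w`-TYPE IS SHIMURA'S `ξ₂`.**  For `hᴴ J h = J`, `k : ℤ`, `s : ℂ` and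
EVERY index `T`: `∫ e(−τ(T·X_r)) f⁰_{s,k}(J n(X_r) h) dr = det d^{−k}·|det d|^{k−2s−2}·e(τ(T·U))·(1/8)·ξ₂(V, T; s+1+k/2, s+1−k/2)` with
`h·i1 = U + iV`, `U = ½(Z + Zᴴ)`, `V = (2i)⁻¹(Z − Zᴴ)`, `Z = moeb h (i1)`, `d = denom h (i1)`.  No convergence hypothesis (identity of Bochner
integrals).  The case `T = 0` followed by ★ `xiTwo_zero_right` is ★ (A∞-R). [Shimura1982, (1.25), (3.2)–(3.3)] [Shimura1997, §16.4] -/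
theorem twistedArchIntertwining_archScalarSection_eq (k : ℤ) (s : ℂ) {h : Matrix (Fin 2 ⊕ Fin 2) (Fin 2 ⊕ Fin 2) ℂ}
    (hh : hᴴ * Matrix.J (Fin 2) ℂ * h = Matrix.J (Fin 2) ℂ) (T : Matrix (Fin 2) (Fin 2) ℂ) :
    ∫ r : Fin 2 → Fin 2 → ℝ, cexp (-(2 * Real.pi * I) * (T * hermOfReal r).trace) *
        archScalarSection k s (Matrix.J (Fin 2) ℂ * fromBlocks 1 (hermOfReal r) 0 1 * h) =
      (denom h (I • (1 : Matrix (Fin 2) (Fin 2) ℂ))).det ^ (-k) *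
        ((‖(denom h (I • (1 : Matrix (Fin 2) (Fin 2) ℂ))).det‖ : ℝ) : ℂ) ^ ((k : ℂ) - 2 * s - 2) *
        cexp ((2 * Real.pi * I) * (T * ((2 : ℂ)⁻¹ • (moeb h (I • (1 : Matrix (Fin 2) (Fin 2) ℂ)) +
          (moeb h (I • (1 : Matrix (Fin 2) (Fin 2) ℂ)))ᴴ))).trace) *
        ((1 / 8 : ℂ) * xiTwo ((2 * I)⁻¹ • (moeb h (I • (1 : Matrix (Fin 2) (Fin 2) ℂ)) - (moeb h (I • (1 : Matrix (Fin 2) (Fin 2) ℂ)))ᴴ)) T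
          (s + 1 + k / 2) (s + 1 - k / 2)) := by
  -- names: `Z = h·i1 = U + iV`, `d = j(h, i1)`
  obtain ⟨Z, hZ⟩ : ∃ Z : Matrix (Fin 2) (Fin 2) ℂ, Z = moeb h (I • (1 : Matrix (Fin 2) (Fin 2) ℂ)) := ⟨_, rfl⟩
  obtain ⟨d, hd⟩ : ∃ d : Matrix (Fin 2) (Fin 2) ℂ, d = denom h (I • (1 : Matrix (Fin 2) (Fin 2) ℂ)) := ⟨_, rfl⟩
  obtain ⟨U, hU⟩ : ∃ U : Matrix (Fin 2) (Fin 2) ℂ, U = (2 : ℂ)⁻¹ • (Z + Zᴴ) := ⟨_, rfl⟩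
  obtain ⟨V, hV⟩ : ∃ V : Matrix (Fin 2) (Fin 2) ℂ, V = (2 * I)⁻¹ • (Z - Zᴴ) := ⟨_, rfl⟩
  rw [← hZ, ← hd, ← hU, ← hV]
  have hdu : IsUnit d.det := by
    rw [hd]
    exact isUnit_det_denom hh posDef_im_I_smul_one
  have hVpos : V.PosDef := by
    rw [hV, hZ]
    exact posDef_im_moeb hh posDef_im_I_smul_one
  have hUh : Uᴴ = U := by
    rw [hU]
    exact (isHermitian_re Z).eq
  have hZUV : Z = U + I • V := by
    rw [hU, hV]
    exact (re_add_I_smul_im Z).symm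
  -- (1) the section value, pointwise in `r` (verbatim ★ (A∞-R))
  have hpt : ∀ r : Fin 2 → Fin 2 → ℝ,
      archScalarSection k s (Matrix.J (Fin 2) ℂ * fromBlocks 1 (hermOfReal r) 0 1 * h) =
        (d.det ^ (-k) * (((‖d.det‖ : ℝ) : ℂ) ^ ((k : ℂ) - 2 * s - 2))) *
          ((hermOfReal r + U + I • V).det ^ (-k) * (((‖(hermOfReal r + U + I • V).det‖ : ℝ) : ℂ) ^ ((k : ℂ) - 2 * s - 2))) := by
    intro r
    have hden : denom (Matrix.J (Fin 2) ℂ * fromBlocks 1 (hermOfReal r) 0 1 * h) (I • 1) = (hermOfReal r + U + I • V) * d := by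
      rw [denom_J_mul_transl, ← hd, ← moeb_mul_denom (P := h) (Z := I • 1) (hd ▸ hdu), ← hZ, ← hd, hZUV, ← Matrix.add_mul]
      congr 1
      abel
    rw [archScalarSection_apply, Fintype.card_fin, Nat.cast_ofNat, hden, det_mul, mul_zpow, norm_mul, Complex.ofReal_mul,
      Complex.mul_cpow_ofReal_nonneg (norm_nonneg _) (norm_nonneg _)]
    ring
  -- (2) the twisted integrand, pointwise: constant × e(τ(TU)) × [e(−τ(T(X+U))) G(X+U)]
  have hpt' : ∀ r : Fin 2 → Fin 2 → ℝ,
      cexp (-(2 * Real.pi * I) * (T * hermOfReal r).trace) * archScalarSection k s (Matrix.J (Fin 2) ℂ * fromBlocks 1 (hermOfReal r) 0 1 * h) =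
        (d.det ^ (-k) * (((‖d.det‖ : ℝ) : ℂ) ^ ((k : ℂ) - 2 * s - 2)) * cexp ((2 * Real.pi * I) * (T * U).trace)) *
          (fun Y : Matrix (Fin 2) (Fin 2) ℂ => cexp (-(2 * Real.pi * I) * (T * Y).trace) *
            ((Y + I • V).det ^ (-k) * (((‖(Y + I • V).det‖ : ℝ) : ℂ) ^ ((k : ℂ) - 2 * s - 2)))) (hermOfReal r + U) := by
    intro r
    rw [hpt r, cexp_trace_split T (hermOfReal r) U]
    ring
  -- (3) the integral: constant out, translate by `U`, Jacobian, `ξ₂(V, T)`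
  simp_rw [hpt']
  rw [integral_const_mul, integral_translate hUh (fun Y : Matrix (Fin 2) (Fin 2) ℂ => cexp (-(2 * Real.pi * I) * (T * Y).trace) *
      ((Y + I • V).det ^ (-k) * (((‖(Y + I • V).det‖ : ℝ) : ℂ) ^ ((k : ℂ) - 2 * s - 2)))),
    integral_hermOfReal_eq (fun Y : Matrix (Fin 2) (Fin 2) ℂ => cexp (-(2 * Real.pi * I) * (T * Y).trace) *
      ((Y + I • V).det ^ (-k) * (((‖(Y + I • V).det‖ : ℝ) : ℂ) ^ ((k : ℂ) - 2 * s - 2)))), xiTwo_def]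
  simp_rw [twisted_integrand_eq_of_posDef hVpos T k s]

end Summit.HodgeConjecture.HodgeConjecture.Cruxes.HLiu418.K2LiuArchTwistedIntertwiningScalarSection

end
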